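import Literature.Topology.FourManifolds.LinkFramedUniqueness
import Literature.Topology.FourManifolds.KirbyMovesHandleSlide
import HarnessLib

/-!
# Kirby's theorem ("if" direction, corrected) from the two geometric models

Topic `Literature/Topology/FourManifolds`; sibling of `KirbyMovesSurgery.lean` (decomposition of
the easy direction of Kirby's theorem into the leaves (E), (U), (I), (R), (V), (B), (H)),
`KirbyMovesBlowDown.lean` (reduction of (B) to the named facts (A) shrink, (B) framed uniqueness,
(C) `Knot.blowDownModel`), `KirbyMovesStrictHandleSlide.lean` (the corrected leaf (H) and the
assembly `StrictKirbyEquivalent.nonempty_diffeomorph_of_leaves`) and `KirbyMovesHandleSlide.lean`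
(reduction of the corrected (H) to (B) and the slide model (S)
`FramedLink.IsStrictHandleSlide.slideModel`). Everything here is proved; no definition and no
named fact is introduced.

Using the framed uniqueness of tubular neighbourhoods of a link on the unit tubes, proved in
`LinkFramedUniqueness.lean` (`Link.exists_diffeomorph_eq_of_hasFraming`, with
`Link.IsSurgeryPresentation.exists_small_tubes`, `Link.IsSurgeryPresentation.transport_eq`), the
named facts (A) `Link.IsSurgeryPresentation.shrink` and (B) `Knot.TubularNbhd.framedUniqueness`
are removed from both reductions:

* `Literature.Topology.FourManifolds.FramedLink.IsBlowDown.isSurgery_of_blowDownModel :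
  Knot.blowDownModel → FramedLink.IsBlowDown.isSurgery` — leaf (B) from the blow-down model (C)
  alone (R. C. Kirby, *The Topology of 4-Manifolds* (1989), Ch. I §5, Thm 5.1, move (2));
* `Literature.Topology.FourManifolds.FramedLink.IsStrictHandleSlide.isSurgery_of_slideModel :
  FramedLink.IsStrictHandleSlide.slideModel → FramedLink.IsStrictHandleSlide.isSurgery` — the
  corrected leaf (H) from the slide model (S) alone (Kirby (1989), Ch. I §4 p. 10, §5 Thm 5.1,
  move (1));
* `Literature.Topology.FourManifolds.StrictKirbyEquivalent.nonempty_diffeomorph_of_models :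
  Knot.blowDownModel → FramedLink.IsStrictHandleSlide.slideModel →
  StrictKirbyEquivalent.nonempty_diffeomorph` — **Kirby's theorem, "if" direction (corrected),
  from the two models**, the leaves (E) (`FramedLink.exists_isSurgery_holds`,
  `LinkSurgeryExistence.lean`), (U) (`FramedLink.IsSurgery.nonempty_diffeomorph_holds`,
  `LinkSurgeryFramedUniqueness.lean`), (I), (R), (V) being proved in the tree.

The proofs of the first two are those of `FramedLink.IsBlowDown.isSurgery_of` and
`FramedLink.IsStrictHandleSlide.isSurgery_of` with the uses of (A), (B) replaced;
`IsIntegralSurgery.exists_presentation'` is `IsIntegralSurgery.exists_presentation` without (B)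
(from the tree's `Knot.TubularNbhd.exists_diffeomorph_eq_of_hasFraming`).

## References

* R. C. Kirby, *The Topology of 4-Manifolds*, Lecture Notes in Math. 1374, Springer (1989),
  Ch. I §4 (p. 10), §5 Thm 5.1 (p. 12), moves (1), (2). [cite: Kirby1989, Ch. I §5 Thm 5.1]
* R. Kirby, *A calculus for framed links in `S³`*, Invent. Math. 45 (1978), 35–56, Thm 1.
  [cite: Kirby1978, Thm 1 "if"]
* A. Juhász, *Differential and Low-Dimensional Topology* (2023), §6.1, Thm 6.4.
  [cite: Juhasz2023, §6.1 Thm 6.4]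
* D. Rolfsen, *Knots and Links* (1976), §9.F. [cite: Rolfsen1976, §9.F]
  A. Kosinski, *Differential Manifolds* (1993), Ch. III Thm (3.5), Ch. VI §1.
-/

noncomputable section

open Set Function
open scoped Manifold ContDiff Topology

namespace Literature.Topology.FourManifolds

section Models

universe v w u'

/-- **A surgery on a knot can be presented with any tubular neighbourhood of the right framing**
(`IsIntegralSurgery.exists_presentation` of `KirbyMovesHandleSlide.lean` without its hypothesis
(B), from the tree's `Knot.TubularNbhd.exists_diffeomorph_eq_of_hasFraming`): if `Yⱼ` is
`m`-surgery on `K` and `νⱼ` is an oriented tubular neighbourhood of `K` of framing `m`, then `Yⱼ`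
is the open gluing of `S³ ∖ K` and `D̊² × S¹` along `surgeryRel νⱼ`, by explicit gluing maps.
Rolfsen (1976), §9.F; Gompf–Stipsicz (1999), §5.3. [cite: Rolfsen1976, §9.F] -/
theorem IsIntegralSurgery.exists_presentation' {K : Knot} {m : ℤ} {Yⱼ : Type*}
    [TopologicalSpace Yⱼ] [ChartedSpace (EuclideanSpace ℝ (Fin 3)) Yⱼ] [IsManifold (𝓡 3) ∞ Yⱼ]
    (h : IsIntegralSurgery (𝓡 3) Yⱼ K m) (νⱼ : Knot.TubularNbhd K) (hν : νⱼ.HasFraming m) :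
    ∃ (φ : K.complement → Yⱼ) (ψ : solidTorus → Yⱼ),
      Manifold.IsSmoothEmbedding (𝓡 3) (𝓡 3) ∞ φ ∧ IsOpen (range φ) ∧
      Manifold.IsSmoothEmbedding (𝓘(ℝ, EuclideanSpace ℝ (Fin 2)).prod (𝓡 1)) (𝓡 3) ∞ ψ ∧
        IsOpen (range ψ) ∧
      range φ ∪ range ψ = univ ∧ ∀ a b, φ a = ψ b ↔ surgeryRel νⱼ a b := by
  obtain ⟨νE, hνE, φE, ψE, hφE, hφEo, hψE, hψEo, hcovE, hrelE⟩ := h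
  obtain ⟨φB, hBK, hBconj⟩ := Knot.TubularNbhd.exists_diffeomorph_eq_of_hasFraming νE νⱼ hνE hν
  have hmem : ∀ x, x ∈ K.complement ↔ φB.symm x ∈ K.complement := fun x ↦ by
    simp only [SphereEmbedding.mem_complement_iff, mem_range, not_exists]
    refine forall_congr' fun y ↦ not_congr ⟨fun h ↦ ?_, fun h ↦ ?_⟩
    · have h1 : φB.symm (φB (K y)) = K y := φB.symm_apply_apply _
      rw [hBK] at h1
      rw [← h]
      exact h1.symm
    · have := congrArg φB h
      rwa [Diffeomorph.apply_symm_apply, hBK] at this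
  set e := φB.symm.restrOpens K.complement K.complement hmem with he
  refine ⟨φE ∘ e, ψE, isSmoothEmbedding_comp_diffeomorph hφE e, ?_, hψE, hψEo, ?_, fun a b ↦ ?_⟩
  · rw [(EquivLike.surjective e).range_comp]; exact hφEo
  · rw [(EquivLike.surjective e).range_comp]; exact hcovE
  · rw [comp_apply, hrelE]
    change νE.glueRel (φB.symm a) b ↔ νⱼ.glueRel a b
    constructor
    · rintro ⟨u, t, ht, hb, ha⟩
      refine ⟨u, t, ht, hb, ?_⟩
      have := congrArg φB ha
      rwa [Diffeomorph.apply_symm_apply, hBconj u _ (norm_smul_coe_sphere_lt_one ht _)] at this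
    · rintro ⟨u, t, ht, hb, ha⟩
      refine ⟨u, t, ht, hb, ?_⟩
      rw [ha, ← hBconj u _ (norm_smul_coe_sphere_lt_one ht _), Diffeomorph.symm_apply_apply]

/-- **A strict handle slide does not change the surgery, from the slide model (S) alone** — the
corrected leaf (H) of Kirby's theorem (`FramedLink.IsStrictHandleSlide.isSurgery`,
`KirbyMovesStrictHandleSlide.lean`): the assembly `FramedLink.IsStrictHandleSlide.isSurgery_of`
of `KirbyMovesHandleSlide.lean` with its three uses of the named fact (B)
`Knot.TubularNbhd.framedUniqueness` replaced by the proved framed uniqueness of tubular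
neighbourhoods of a link on the unit tubes (`Link.exists_diffeomorph_eq_of_hasFraming`,
`LinkFramedUniqueness.lean`): small tubes by `Link.IsSurgeryPresentation.exists_small_tubes`,
the surgery `Yⱼ` on `Kⱼ` presented with the tube of the presentation by
`IsIntegralSurgery.exists_presentation'`, and the swap of the tube of `Kᵢ` for the one provided by
(S) by `Link.IsSurgeryPresentation.transport_eq`; then, as there, `Y` is surgery on `Yⱼ` along the
pushed tubes of the components `k ≠ j` (`Link.IsSurgeryPresentation.isSurgeryAlongTubes_pushTube`),
hence along their images under the slide diffeomorphism `Φ` of (S), which are the pushed tubes of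
`Kᵢ'` and of the untouched components, i.e. `Y` is surgery on `L'`
(`IsSurgeryAlongTubes.isSurgeryPresentation_optionCons`, renumbering). Kirby (1989), Ch. I §4
p. 10 and §5 Thm 5.1 move (1); Juhász (2023), §6.1 (ii). [cite: Kirby1989, Ch. I §5 Thm 5.1] -/
theorem FramedLink.IsStrictHandleSlide.isSurgery_of_slideModel [Knot.TubularNbhd.SmoothnessFacts]
    (hS : FramedLink.IsStrictHandleSlide.slideModel.{u'}) :
    FramedLink.IsStrictHandleSlide.isSurgery.{v, u'} := by
  intro ι _ L L' Y _ _ _ _ _ h hY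
  classical
  obtain ⟨i, j, hij, ν, l, hrest, hfr, hdisjν, ⟨b⟩, hlk, hfr'⟩ := h
  obtain ⟨μ, hμfr, hμdisj, hpres⟩ := hY
  have hji : j ≠ i := hij.symm
  have hcomp : ∀ k, k ≠ i → L'.component k = L.component k := fun k hk ↦ (hrest k hk).1
  -- (S), first output: an open set `U` containing the components `k ≠ i, j`
  obtain ⟨U, hUo, hKU, hS'⟩ := hS hij ν l b hcomp hfr hdisjν hlk
  -- pairwise disjoint neighbourhoods of the components of `L` and of `L'`
  obtain ⟨P, hPo, hKP, hPd⟩ := L.toLink.exists_isOpen_pairwise_disjoint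
  obtain ⟨O, hOo, hKO, hOd⟩ := L'.toLink.exists_isOpen_pairwise_disjoint
  have hKO' : ∀ k, k ≠ i → range ⇑(L.component k) ⊆ O k := fun k hk ↦ hcomp k hk ▸ hKO k
  -- the prescribed neighbourhoods of the components of `L`
  set V : ι → Set (Metric.sphere (0 : EuclideanSpace ℝ (Fin 4)) 1) := fun k ↦
    if k = i then P i else if k = j then P j ∩ O j ∩ range ⇑ν else P k ∩ O k ∩ U with hV
  have hVi : V i = P i := by simp [hV]
  have hVj : V j = P j ∩ O j ∩ range ⇑ν := by simp [hV, hji]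
  have hVk : ∀ k, k ≠ i → k ≠ j → V k = P k ∩ O k ∩ U := fun k hki hkj ↦ by simp [hV, hki, hkj]
  have hVo : ∀ k, IsOpen (V k) := by
    intro k
    by_cases hki : k = i
    · subst hki; rw [hVi]; exact hPo _
    by_cases hkj : k = j
    · subst hkj; rw [hVj]
      exact ((hPo _).inter (hOo _)).inter ν.toTubeNbhd.isOpen_range
    · rw [hVk k hki hkj]; exact ((hPo _).inter (hOo _)).inter hUo
  have hKV : ∀ k, range ⇑(L.component k) ⊆ V k := by
    intro k
    by_cases hki : k = i
    · subst hki; rw [hVi]; exact hKP _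
    by_cases hkj : k = j
    · subst hkj; rw [hVj]
      exact subset_inter (subset_inter (hKP _) (hKO' _ hki)) ν.range_subset_range
    · rw [hVk k hki hkj]
      exact subset_inter (subset_inter (hKP k) (hKO' k hki)) (hKU k hki hkj)
  have hVP : ∀ k, V k ⊆ P k := by
    intro k
    by_cases hki : k = i
    · subst hki; rw [hVi]
    by_cases hkj : k = j
    · subst hkj; rw [hVj]; exact inter_subset_left.trans inter_subset_left
    · rw [hVk k hki hkj]; exact inter_subset_left.trans inter_subset_left
  have hVO : ∀ k, k ≠ i → V k ⊆ O k := by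
    intro k hki
    by_cases hkj : k = j
    · subst hkj; rw [hVj]; exact inter_subset_left.trans inter_subset_right
    · rw [hVk k hki hkj]; exact inter_subset_left.trans inter_subset_right
  have hVd : Pairwise fun k k' ↦ Disjoint (V k) (V k') := fun k k' hkk' ↦
    (hPd hkk').mono (hVP k) (hVP k')
  -- (A″): re-present `Y` on `L` with small tubes
  obtain ⟨μ₁, hμ₁fr, hμ₁V, -, hpres₁⟩ :=
    Link.IsSurgeryPresentation.exists_small_tubes hμfr hμdisj hpres V hVo hKV
  have hμ₁d : Pairwise fun k k' ↦ Disjoint (range ⇑(μ₁ k)) (range ⇑(μ₁ k')) := fun k k' hkk' ↦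
    (hVd hkk').mono (hμ₁V k) (hμ₁V k')
  -- the surgery `Yⱼ` on `Kⱼ`, presented with the tube `μ₁ j`
  obtain ⟨Yⱼ, _, _, _, _, _, _, hYⱼ⟩ := exists_isIntegralSurgery_holds (L.component j) (L.framing j)
  obtain ⟨φ, ψ, hφ, hφo, hψ, hψo, hcov, hrel⟩ := hYⱼ.exists_presentation' (μ₁ j) (hμ₁fr j)
  -- the compact union `T` of the closed unit tubes of the components `k ≠ i, j`
  set T : Set (Metric.sphere (0 : EuclideanSpace ℝ (Fin 4)) 1) := ⋃ k : {k : ι // k ≠ i ∧ k ≠ j},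
    μ₁ k.1 '' (univ ×ˢ Metric.closedBall (0 : EuclideanSpace ℝ (Fin 2)) 1) with hT
  have hTc : IsCompact T := isCompact_iUnion fun k ↦
    (isCompact_univ.prod (isCompact_closedBall _ _)).image (μ₁ k.1).continuous
  have hTU : T ⊆ U := iUnion_subset fun k ↦ (image_subset_range _ _).trans
    ((hμ₁V k.1).trans (by rw [hVk k.1 k.2.1 k.2.2]; exact inter_subset_right))
  -- (S): the slide diffeomorphism and the tubes of `Kᵢ`, `Kᵢ'`
  obtain ⟨Φ, μᵢ, μᵢ', hμᵢfr, hμᵢ'fr, hμᵢV, hμᵢ'V, hμᵢK, -, hΦT, hΦμ⟩ :=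
    hS' (μ₁ j) (hμ₁fr j) ((hμ₁V j).trans (by rw [hVj]; exact inter_subset_right))
      φ ψ hφ hφo hψ hψo hcov hrel T hTc hTU (V i) (hVo i) (hKV i) (O i) (hOo i) (hKO i)
  -- swap the tube of `Kᵢ` for `μᵢ` (framed uniqueness of tubular neighbourhoods of the link)
  set μ₂ : ∀ k, Knot.TubularNbhd (L.component k) := Function.update μ₁ i μᵢ with hμ₂
  have hμ₂i : μ₂ i = μᵢ := Function.update_self i μᵢ μ₁
  have hμ₂k : ∀ k, k ≠ i → μ₂ k = μ₁ k := fun k hk ↦ Function.update_of_ne hk μᵢ μ₁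
  have hμ₂V : ∀ k, range ⇑(μ₂ k) ⊆ V k := by
    intro k
    by_cases hk : k = i
    · subst hk; rw [hμ₂i]; exact hμᵢV
    · rw [hμ₂k k hk]; exact hμ₁V k
  have hμ₂d : Pairwise fun k k' ↦ Disjoint (range ⇑(μ₂ k)) (range ⇑(μ₂ k')) := fun k k' hkk' ↦
    (hVd hkk').mono (hμ₂V k) (hμ₂V k')
  have hμ₂fr : ∀ k, (μ₂ k).HasFraming (L.framing k) := by
    intro k
    by_cases hk : k = i
    · subst hk; rw [hμ₂i]; exact hμᵢfr
    · rw [hμ₂k k hk]; exact hμ₁fr k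
  obtain ⟨F₂, hF₂fix, hF₂conj⟩ :=
    L.toLink.exists_diffeomorph_eq_of_hasFraming μ₁ μ₂ hμ₁d hμ₂d hμ₁fr hμ₂fr
  have hpres₂ : L.toLink.IsSurgeryPresentation (𝓡 3) Y μ₂ := hpres₁.transport_eq F₂ hF₂fix hF₂conj
  -- (S1): `Y` is surgery on `Yⱼ` along the pushed tubes of the components `k ≠ j`
  have hrel₂ : ∀ a c, φ a = ψ c ↔ surgeryRel (μ₂ j) a c := by rw [hμ₂k j hji]; exact hrel
  have hS1 := hpres₂.isSurgeryAlongTubes_pushTube hμ₂d j φ ψ hφ hφo hψ hψo hcov hrel₂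
  have hS1' := (hS1.transport Φ).reindex (slideIndexEquiv hij)
  -- the link `Kᵢ' ⊔ (Kₖ)_{k ≠ i, j}` and its tubes
  set L₀ : Link {k : ι // k ≠ i ∧ k ≠ j} :=
    L.toLink.comap (fun k : {k : ι // k ≠ i ∧ k ≠ j} ↦ k.1) (fun _ _ e ↦ Subtype.ext e) with hL₀
  have hK'L₀ : ∀ k : {k : ι // k ≠ i ∧ k ≠ j},
      Disjoint (range ⇑(L'.component i)) (range ⇑(L₀.component k)) :=
    fun k ↦ by
      rw [Link.comap_component, ← hcomp k.1 k.2.1]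
      exact L'.disjoint (Ne.symm k.2.1)
  set L'' : Link (Option {k : ι // k ≠ i ∧ k ≠ j}) :=
    Link.optionCons (L'.component i) L₀ hK'L₀ with hL''
  set μ₃ : ∀ o, Knot.TubularNbhd (L''.component o) := Link.optionNbhd μᵢ' fun k ↦ μ₁ k.1 with hμ₃
  have hμ₃O : ∀ o, range ⇑(μ₃ o) ⊆ O ((slideIndexEquiv hij o).1) := by
    rintro (_ | k)
    · exact hμᵢ'V
    · exact (hμ₁V k.1).trans (hVO k.1 k.2.1)
  have hμ₃j : ∀ o, Disjoint (range ⇑(μ₃ o)) (range ⇑(μ₁ j)) := fun o ↦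
    (hOd (slideIndexEquiv hij o).2).mono (hμ₃O o) ((hμ₁V j).trans (hVO j hji))
  have hS2in : IsSurgeryAlongTubes (𝓡 3) (𝓡 3) Y fun o ↦
      Knot.pushTube φ (μ₃ o) ((hμ₃j o).mono_right (μ₁ j).range_subset_range) := by
    refine hS1'.congr fun o x w hw ↦ ?_
    rcases o with _ | k
    · change Φ (φ ⟨μ₂ i (x, w), _⟩) = φ ⟨μᵢ' (x, w), _⟩
      have e1 : μ₂ i (x, w) = μᵢ (x, w) := by rw [hμ₂i]
      generalize_proofs h₁ h₂
      revert h₁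
      rw [e1]
      intro h₁
      exact hΦμ x w hw h₁ h₂
    · change Φ (φ ⟨μ₂ k.1 (x, w), _⟩) = φ ⟨μ₁ k.1 (x, w), _⟩
      have e1 : μ₂ k.1 (x, w) = μ₁ k.1 (x, w) := by rw [hμ₂k k.1 k.2.1]
      have hxT : (μ₁ k.1 (x, w) : Metric.sphere (0 : EuclideanSpace ℝ (Fin 4)) 1) ∈ T :=
        mem_iUnion.2 ⟨k, ⟨(x, w), ⟨mem_univ _, by simpa using hw.le⟩, rfl⟩⟩
      generalize_proofs h₁ h₂
      revert h₁
      rw [e1]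
      intro h₁
      exact hΦT _ hxT
  -- (S2): back to a surgery presentation in `S³`
  have hS2 := IsSurgeryAlongTubes.isSurgeryPresentation_optionCons (μ₁ j) φ ψ hφ hφo hψ hψo hcov
    hrel L'' μ₃ hμ₃j hS2in
  -- renumber: `L'` versus `Kⱼ ⊔ (Kᵢ' ⊔ (Kₖ)ₖ)`
  set e₂ : Option (Option {k : ι // k ≠ i ∧ k ≠ j}) ≃ ι :=
    (Equiv.optionCongr (slideIndexEquiv hij)).trans (Equiv.optionSubtypeNe j) with he₂
  have he₂n : e₂ none = j := rfl
  have he₂s : ∀ o, e₂ (some o) = (slideIndexEquiv hij o).1 := fun o ↦ rfl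
  suffices hfin : (L'.reindex e₂).IsSurgery (𝓡 3) Y from
    (FramedLink.isSurgery_reindex_iff_holds e₂ L').1 hfin
  have hKL'' : ∀ o, Disjoint (range ⇑(L.component j)) (range ⇑(L''.component o)) := fun o ↦
    ((hμ₃j o).mono (μ₃ o).range_subset_range (μ₁ j).range_subset_range).symm
  set Lfin : Link (Option (Option {k : ι // k ≠ i ∧ k ≠ j})) :=
    Link.optionCons (L.component j) L'' hKL'' with hLfin
  set νfin : ∀ o, Knot.TubularNbhd (Lfin.component o) := Link.optionNbhd (μ₁ j) μ₃ with hνfin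
  have hLeq : (L'.reindex e₂).toLink = Lfin := by
    refine Link.ext_component (funext fun o ↦ ?_)
    rcases o with _ | _ | k
    · exact hcomp j hji
    · rfl
    · exact hcomp k.1 k.2.1
  change IsIntegralSurgeryLink (𝓡 3) Y (L'.reindex e₂).toLink (L'.reindex e₂).framing
  rw [hLeq]
  refine ⟨νfin, ?_, ?_, hS2⟩
  · rintro (_ | _ | k)
    · change (μ₁ j).HasFraming (L'.framing (e₂ none))
      rw [he₂n, (hrest j hji).2]
      exact hμ₁fr j
    · change μᵢ'.HasFraming (L'.framing (e₂ (some none)))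
      rw [he₂s, show (slideIndexEquiv hij none).1 = i from rfl, hfr']
      exact hμᵢ'fr
    · change (μ₁ k.1).HasFraming (L'.framing (e₂ (some (some k))))
      rw [he₂s, show (slideIndexEquiv hij (some k)).1 = k.1 from rfl, (hrest k.1 k.2.1).2]
      exact hμ₁fr k.1
  · have hsub : ∀ o, range ⇑(νfin o) ⊆ O (e₂ o) := by
      rintro (_ | o)
      · exact (hμ₁V j).trans (hVO j hji)
      · exact hμ₃O o
    exact fun o o' hoo' ↦ (hOd (e₂.injective.ne hoo')).mono (hsub o) (hsub o')

/-- **Blowing down does not change the surgery, from the blow-down model (C) alone** — leaf (B)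
of Kirby's theorem (`FramedLink.IsBlowDown.isSurgery`, `KirbyMovesSurgery.lean`): the assembly
`FramedLink.IsBlowDown.isSurgery_of` of `KirbyMovesBlowDown.lean` with its uses of the named
facts (A) `Link.IsSurgeryPresentation.shrink` and (B) `Knot.TubularNbhd.framedUniqueness`
replaced by the proved `Link.IsSurgeryPresentation.exists_small_tubes` and
`Link.exists_diffeomorph_eq_of_hasFraming` (`LinkFramedUniqueness.lean`). Given
`IsBlowDown ε L L'` and a surgery presentation of `Y` on `L`: choose an open
`W ⊇ d(D̄²) ∪ ν₀(S¹ × D̄²)` whose closure misses the other components; re-present with tubes whose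
images lie in `W` (component `none`) resp. off `W̄` (the others); let (C) present `S³` as
`ε`-surgery on `K₀` with a tube `ν_C ⊆ W` and gluing maps standard off `W`; match the tube of
`K₀` with `ν_C` by a diffeomorphism of `S³` fixing `L` and the other unit tubes; conclude by the
relative blow-down step `Link.someLink_isIntegralSurgeryLink`. Kirby (1989), Ch. I §5, Thm 5.1,
move (2); Juhász (2023), §6.1 (i). [cite: Kirby1989, Ch. I §5 Thm 5.1] -/
theorem FramedLink.IsBlowDown.isSurgery_of_blowDownModel (hC : Knot.blowDownModel) :
    FramedLink.IsBlowDown.isSurgery.{v, u'} := by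
  intro ι _ ε L L' Y _ _ _ _ _ h hY
  classical
  obtain ⟨hcomp, hε, d, hd, hdK, hdisjd⟩ := h
  -- identify `L'` with `L.someLink`
  obtain ⟨⟨c', hc'⟩, f'⟩ := L'
  obtain rfl : (fun i ↦ L.component (some i)) = c' := funext fun i ↦ (hcomp i).1
  obtain rfl : (fun i ↦ L.framing (some i)) = f' := funext fun i ↦ (hcomp i).2
  change IsIntegralSurgeryLink (𝓡 3) Y L.toLink.someLink fun i ↦ L.framing (some i)
  obtain ⟨ν, hfr, hdisjν, hpres⟩ := hY
  -- the compact sets `D = d(D̄²)`, `T = ν₀(S¹ × D̄²)` and the closed set of the other components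
  set K₀ : Knot := L.component none with hK₀
  have hdcont : Continuous d := hd.1.continuous
  set D := d '' Metric.closedBall (0 : EuclideanSpace ℝ (Fin 2)) 1 with hD
  have hDc : IsCompact D := (isCompact_closedBall _ _).image hdcont
  set T := ν none '' (univ ×ˢ Metric.closedBall (0 : EuclideanSpace ℝ (Fin 2)) 1) with hT
  have hTc : IsCompact T :=
    (isCompact_univ.prod (isCompact_closedBall _ _)).image (ν none).continuous
  set Kset := ⋃ i : ι, range (L.component (some i)) with hKset
  have hKsetc : IsClosed Kset :=
    isClosed_iUnion_of_finite fun i ↦ (L.component (some i)).isClosed_range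
  have hDK : Disjoint D Kset := by
    rw [hKset, disjoint_iUnion_right]
    exact fun i ↦ hdisjd i
  have hTK : Disjoint T Kset := by
    rw [hKset, disjoint_iUnion_right]
    intro i
    refine Disjoint.mono ?_ (ν (some i)).range_subset_range (hdisjν (Option.some_ne_none i).symm)
    rintro _ ⟨p, -, rfl⟩
    exact mem_range_self p
  -- an open `W ⊇ D ∪ T` whose closure misses the other components
  obtain ⟨W, hWo, hDTW, hWK⟩ : ∃ W, IsOpen W ∧ D ∪ T ⊆ W ∧ closure W ⊆ Ksetᶜ :=
    normal_exists_closure_subset (hDc.union hTc).isClosed hKsetc.isOpen_compl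
      (Set.subset_compl_iff_disjoint_right.2 (hDK.union_left hTK))
  have hKW : ∀ (i : ι) x, L.component (some i) x ∉ closure W := fun i x hx ↦
    hWK hx (mem_iUnion.2 ⟨i, mem_range_self x⟩)
  -- re-present with small tubes: inside `W` (component `none`), off `W̄` (the others)
  obtain ⟨ν₁, hfr₁, hsmall₁, hrange₁, hpres₁⟩ := Link.IsSurgeryPresentation.exists_small_tubes
    hfr hdisjν hpres (fun i ↦ Option.elim i W fun _ ↦ (closure W)ᶜ)
    (fun i ↦ by cases i with
      | none => exact hWo
      | some i => exact isClosed_closure.isOpen_compl)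
    (fun i ↦ by cases i with
      | none =>
        rintro _ ⟨x, rfl⟩
        refine hDTW (Or.inl ⟨x, ?_, hdK x⟩)
        simp [norm_eq_of_mem_sphere x]
      | some i =>
        rintro _ ⟨x, rfl⟩
        exact hKW i x)
  have hdisj₁ : Pairwise fun i j : Option ι ↦ Disjoint (range (ν₁ i)) (range (ν₁ j)) :=
    fun i j hij ↦ (hdisjν hij).mono (hrange₁ i) (hrange₁ j)
  have hT₁ : ∀ (i : ι) x (w : EuclideanSpace ℝ (Fin 2)), ν₁ (some i) (x, w) ∉ closure W :=
    fun i x w h ↦ hsmall₁ (some i) (mem_range_self _) h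
  -- (C): `S³` is `ε`-surgery on `K₀` relative to `W`
  obtain ⟨νC, hfrC, hrangeC, φ, ψ, hφ, hφo, hψ, hψo, hcovC, hrelC, hφid, hφW, hψW⟩ :=
    hC K₀ d hd hdK ε W hWo (subset_union_left.trans hDTW)
  -- match the tube of `K₀` with `νC` (framed uniqueness of tubular neighbourhoods of the link)
  set ν₂ : ∀ i, Knot.TubularNbhd (L.component i) := Function.update ν₁ none νC with hν₂
  have hν₂n : ν₂ none = νC := Function.update_self none νC ν₁
  have hν₂s : ∀ i : ι, ν₂ (some i) = ν₁ (some i) := fun i ↦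
    Function.update_of_ne (Option.some_ne_none i) νC ν₁
  have hfr₂ : ∀ i, (ν₂ i).HasFraming (L.framing i) := fun i ↦ by
    cases i with
    | none => rw [hν₂n, hε]; exact hfrC
    | some i => rw [hν₂s]; exact hfr₁ (some i)
  have hdisj₂ : Pairwise fun i j : Option ι ↦ Disjoint (range (ν₂ i)) (range (ν₂ j)) := by
    have key : ∀ i : ι, Disjoint (range ⇑(ν₂ none)) (range ⇑(ν₂ (some i))) := fun i ↦ by
      rw [hν₂n, hν₂s]
      refine Set.disjoint_left.2 fun p hp hp' ↦ ?_
      obtain ⟨q, rfl⟩ := hp'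
      exact hT₁ i q.1 q.2 (subset_closure (hrangeC hp))
    rintro (_ | i) (_ | j) hij
    · exact absurd rfl hij
    · exact key j
    · exact (key i).symm
    · rw [hν₂s, hν₂s]; exact hdisj₁ hij
  obtain ⟨F, hFfix, hFconj⟩ :=
    L.toLink.exists_diffeomorph_eq_of_hasFraming ν₁ ν₂ hdisj₁ hdisj₂ hfr₁ hfr₂
  have hpres₂ : L.toLink.IsSurgeryPresentation (𝓡 3) Y ν₂ := hpres₁.transport_eq F hFfix hFconj
  -- the relative blow-down step
  have hrelC' : ∀ a b, φ a = ψ b ↔ surgeryRel (ν₂ none) a b := by rw [hν₂n]; exact hrelC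
  exact Link.someLink_isIntegralSurgeryLink ν₂ hfr₂
    (fun i j hij ↦ by
      change Disjoint (range ⇑(ν₂ (some i))) (range ⇑(ν₂ (some j)))
      rw [hν₂s, hν₂s]
      exact hdisj₁ fun h ↦ hij (Option.some_injective _ h))
    hpres₂ W (fun i x w _ h ↦ by rw [hν₂s] at h; exact hT₁ i x w (subset_closure h)) φ ψ hφ hφo
    hψ hψo hcovC hrelC' hφid hφW hψW


/-- **Kirby's theorem, "if" direction (corrected statement
`StrictKirbyEquivalent.nonempty_diffeomorph`), from the two geometric models only**: the blow-down
model (C) `Knot.blowDownModel` (`KirbyMovesBlowDown.lean`) and the slide model (S)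
`FramedLink.IsStrictHandleSlide.slideModel` (`KirbyMovesHandleSlide.lean`). The other leaves of the
decomposition recorded in `KirbyMovesSurgery.lean` are proved in the tree: existence (E)
`FramedLink.exists_isSurgery_holds` (`LinkSurgeryExistence.lean`), uniqueness (U)
`FramedLink.IsSurgery.nonempty_diffeomorph_holds` (`LinkSurgeryFramedUniqueness.lean`), (I), (R),
(V), and now (B) from (C) (`FramedLink.IsBlowDown.isSurgery_of_blowDownModel`) and (H) from (S)
(`FramedLink.IsStrictHandleSlide.isSurgery_of_slideModel`), assembled by
`StrictKirbyEquivalent.nonempty_diffeomorph_of_leaves` (`KirbyMovesStrictHandleSlide.lean`).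
Kirby (1978), Thm 1 "if"; Kirby (1989), Ch. I §5 Thm 5.1; Juhász (2023), Thm 6.4.
[cite: Kirby1978, Thm 1 "if"] -/
theorem StrictKirbyEquivalent.nonempty_diffeomorph_of_models [SphereEmbedding.SmoothnessFacts]
    [Knot.TubularNbhd.SmoothnessFacts] (hC : Knot.blowDownModel)
    (hS : FramedLink.IsStrictHandleSlide.slideModel.{0}) :
    StrictKirbyEquivalent.nonempty_diffeomorph.{v, w} :=
  StrictKirbyEquivalent.nonempty_diffeomorph_of_leaves FramedLink.exists_isSurgery_holds
    FramedLink.IsSurgery.nonempty_diffeomorph_holds FramedLink.IsSurgery.nonempty_diffeomorph_holds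
    FramedLink.IsSurgery.nonempty_diffeomorph_holds
    (FramedLink.IsBlowDown.isSurgery_of_blowDownModel hC)
    (FramedLink.IsStrictHandleSlide.isSurgery_of_slideModel hS)

end Models

end Literature.Topology.FourManifolds
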